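/-
Copyright (c) 2026 the pub-hodgecm-mathlib formalisation cell (harness21).  Prover seat hodgecm-mathlib-LH4-p08 (g9), req620 Track A «(D-RAM) FOUR-FRAME» squad, helper lane
on h413 = stmt-HodgeConjecture-24833 (count-neutral).  STAGE-1b, row (2), RamM lane of the (LAW) END — (R2-frame) «THE CUT WELD OF THE FRAME AT THE SCALED MULTIPLIER»,
both parity classes, over (R1) (this seat) and (R2) ED. 2 ★ p860773 (this seat); adapted from ★ `toricCensusSum_ramM_weld_of_frame` (LH4-p04 (g5)).  2026-09-04.
-/
import Summits.HodgeConjecture.HodgeConjecture.Theorems.F0P3cDyRamToricCensusSumRamMWeldOfFrame          -- ★ (LH4-p04 (g5)): brings K′ package ★ p857945, tables ★ p858235∕p858252, class letters, ★ RamMDep, ★ near∕WeldFar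
import Summits.HodgeConjecture.HodgeConjecture.Theorems.F0P3cDyRamToricCensusSumRamMWeldCutV2            -- ★ p860773 (this seat): (R2) ED. 2 `toricCensusSum_ramM_weld_cut[_flip]_v2`
import Summits.HodgeConjecture.HodgeConjecture.Theorems.F0P3cDyRamToricLevelCensusRamMTopCellsScaled     -- (this seat): (R1) `tokens_inv_mul`, `hC2TOPnear_of_letters_inv_mul`, `hC2TOPfarE_of_letters_inv_mul`
import HarnessLib

/-!
# Crux `H413`, line LH4 «(D-RAM) FOUR-FRAME» — STAGE-1b, row (2), RamM lane: (R2-frame) «THE CUT WELD OF THE FRAME AT THE SCALED MULTIPLIER» (both parity classes)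

Cell `hodgecm-mathlib` (D-0151), FLOOR 0, crux item H413 = `stmt-HodgeConjecture-24833`, route of record `HCCMUnconditional`; squad F0∕P3c∕LH4 (req618∕req620); helper lane
`--supports stmt-HodgeConjecture-24833 --as helper` (count-neutral).  THEOREMS ONLY (no `def`, no instance, no notation, no named fact, no `sorry`; default heartbeats).

The RamM twin of ★ p859906 ∕ ★ p859944 (LH4-p07 (g9), type RamK): ★ `toricCensusSum_ramM_weld_of_frame` (LH4-p04 (g5)) discharges every per-cell fact of the (C) weld from the
FRAME LETTERS of one abstract dyadic field at the multiplier `λ − u`; the level socket `levelsCensusC` (LH4-p07 (g9)) needs the same at the SCALED multiplier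
`μ₁ = tc⁻¹(λ − u)` (`ρ tc = tc`, `|tc| = |ϖE|^{eo}`, `eo ≤ g + s0`), with the census CUT at `j + a ≤ C`.  At μ₁ the tokens are `(m₁, jl₁) = (m − eo, jl − eo)` and the twist
is unchanged ((R1) `tokens_inv_mul`), so: the u-free tables (C-1) are μ-free; GEN∕OFF is ★ `levelSetDep_eq_of_generic_ramified` at μ₁'s tokens; the near top cells agree
((R1) `hC2TOPnear_of_letters_inv_mul` over ★ p858164); the far top cells carry the ALIVE OFFSET `2j + (g+s0) ≤ 2jl₁ + 1 + eo` ((R1) `hC2TOPfarE_of_letters_inv_mul` — the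
far law read at the free radius `c = j + a − m₁`); and ★ p860773 `toricCensusSum_ramM_weld_cut_v2` ∕ `_flip_v2` (this seat, EDITION 2: `hparW` = parity OR window, so BOTH
regimes of `hreg`) welds them.  The parity CLASS is `eo`'s: `eo` even ⇒ `jl₁ ≡ g` (standard tables), `eo` odd ⇒ `jl₁ ≡ g + 1` (flipped tables).
* **`toricCensusSum_ramM_weld_cut_of_frame`** (`eo` even) and **`toricCensusSum_ramM_weld_cut_of_frame_flip`** (`eo` odd): ★ `toricCensusSum_ramM_weld_of_frame`'s binders
  VERBATIM + `{tc} (hρt) {eo} (hte) (heo) {m₁ jl₁} (hme) (hjle')` + `(hed : eo ≤ g + s0)` + the weld's depth guard at `jl₁` + the cut `(C) (hC) (hCe)` ⊢ ★ p860773's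
  conclusion at `(m₁, jl₁, μ₁)` VERBATIM.
HONEST LABEL.  Count-neutral; one abstract frame, no CM place, no law asserted; the side letters are HYPOTHESES ((C-5b), as in ★ (C)); `HC_CM` is proved only modulo the
7 printed citations (2 remaining named inputs: hLiu418 = `stmt-HodgeConjecture-24832`, h413 = `stmt-HodgeConjecture-24833`) until rung 0 closes.

## References
* [Rogawski1990] J. D. Rogawski, *Automorphic Representations of Unitary Groups in Three Variables*, Ann. of Math. Stud. 123 (1990): §4.9 pp. 55–58, Prop. 4.9.1, Lemma 4.9.3.
* [Kottwitz1986BaseChangeUnits] R. E. Kottwitz, *Base change for unit elements of Hecke algebras*, Compositio Math. 60 (1986): §1 pp. 240–241.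
* [Flicker1998UnitaryFL] Y. Z. Flicker, *Elementary proof of the fundamental lemma for a unitary group*, Canad. J. Math. 50 (1998): Prop. 7 p. 84.
* [Serre1979] J.-P. Serre, *Local Fields*, GTM 67 (1979): Ch. IV §1–§2, Ch. V §3.
-/

set_option autoImplicit false

noncomputable section

open scoped Valued Classical
open WithZero IsLocalRing Finset
open Literature.NumberTheory.Automorphic.UnitaryThreeFourFrame (IsRamifiedQuadraticDatum)
open Summit.HodgeConjecture.HodgeConjecture.Cruxes.H413.F0P3cDyRamToricCensusDefs
open Summit.HodgeConjecture.HodgeConjecture.Cruxes.H413.F0P3cDyRamToricLevelCensusRamM (levelSetDep_eq_of_generic_ramified ncard_levelSet_eq_hnP ncard_levelSet_eq_hnM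
  tokens_inv_mul hC2TOPnear_of_letters_inv_mul hC2TOPfarE_of_letters_inv_mul)
open Summit.HodgeConjecture.HodgeConjecture.Cruxes.H413.F0P3cDyRamToricLevelCensusRamMAtThirdField (exists_thirdFieldPackage_ramM)
open Summit.HodgeConjecture.HodgeConjecture.Cruxes.H413.F0P3cDyRamClassLettersRelative (exists_relative_translator)
open Summit.HodgeConjecture.HodgeConjecture.Cruxes.H413.F0P3cDyRamToricCensusSumRamMWeldCutV2 (toricCensusSum_ramM_weld_cut_v2 toricCensusSum_ramM_weld_cut_flip_v2)

namespace Summit.HodgeConjecture.HodgeConjecture.Cruxes.H413.F0P3cDyRamToricCensusSumRamMWeldCutOfFrame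

/-! ## §0 Token arithmetic of the scaled multiplier -/

/-- Standard class (`eo` even): from `(m, jl)` to `(m₁, jl₁) = (m − eo, jl − eo)` — the class of `jl₁`, the parity-or-window letter, the weld's `m`-guard, `m₁ ≤ jl₁`,
the sign window, and the far organ's guards `g + s0 ≤ m + 1`, `2s0 + g ≤ jl + 2`. -/
theorem scaledLetters_std {m m₁ eo jl jl₁ g s0 : ℕ} (heo : eo % 2 = 0) (hed : eo ≤ g + s0) (hme : m₁ + eo = m) (hjle : jl₁ + eo = jl)
    (hjlg : jl % 2 = g % 2) (hmjl : m ≤ jl) (hdeep : 3 * (g + s0) ≤ m) (hparW : m % 2 = (g + s0) % 2 ∨ jl + 2 ≤ m + 2 * g + s0) :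
    jl₁ % 2 = g % 2 ∧ (m₁ % 2 = (g + s0) % 2 ∨ jl₁ + 2 ≤ m₁ + 2 * g + s0) ∧ g + s0 - (g + s0) % 2 ≤ m₁ + 1 ∧ m₁ ≤ jl₁ ∧
      (jl + 2 ≤ m + 2 * g + s0 → jl₁ + 2 ≤ m₁ + 2 * g + s0) ∧ g + s0 ≤ m + 1 ∧ 2 * s0 + g ≤ jl + 2 := by
  omega

/-- Flipped class (`eo` odd): as `scaledLetters_std` with `jl₁ ≡ g + 1`, `m₁`'s parity letter flipped and the weld's `m`-guard `g + s0 ≤ m₁ + 1`. -/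
theorem scaledLetters_flip {m m₁ eo jl jl₁ g s0 : ℕ} (heo : eo % 2 = 1) (hed : eo ≤ g + s0) (hme : m₁ + eo = m) (hjle : jl₁ + eo = jl)
    (hjlg : jl % 2 = g % 2) (hmjl : m ≤ jl) (hdeep : 3 * (g + s0) ≤ m) (hparW : m % 2 = (g + s0) % 2 ∨ jl + 2 ≤ m + 2 * g + s0) :
    jl₁ % 2 = (g + 1) % 2 ∧ (m₁ % 2 = (g + s0 + 1) % 2 ∨ jl₁ + 2 ≤ m₁ + 2 * g + s0) ∧ g + s0 ≤ m₁ + 1 ∧ m₁ ≤ jl₁ ∧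
      (jl + 2 ≤ m + 2 * g + s0 → jl₁ + 2 ≤ m₁ + 2 * g + s0) ∧ g + s0 ≤ m + 1 ∧ 2 * s0 + g ≤ jl + 2 := by
  omega

/-! ## §1 Standard class (`eo` even) -/

/-- **(R2-frame) THE CUT WELD OF THE FRAME AT THE SCALED MULTIPLIER — type RamM, STANDARD CLASS (`eo` even), BOTH PARITY REGIMES.**  ★ `toricCensusSum_ramM_weld_of_frame`'s
frame letters VERBATIM (one abstract dyadic `K`: the three ramified data at `ϖM`, Klein letters, `hF4`, `hFN`, the `Θ`-unit dichotomy and anchor `n₀`, the scalars `h ∕ h′` with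
half-orders, the tokens `|λ − u| = |ϖE|^m`, `|(λ−u) − ρ(λ−u)| = |ϖE^{jl}(ϖM − ρϖM)|`, the (C-5c) letters `hjlg hmjl hdeep hparW hreg`, the sign `ε` with `hεQ` and the four SIDE
LETTERS `hST hSE hSP hSM`), plus the `ρ`-fixed scaling element `tc` (`|tc| = |ϖE|^{eo}`, `eo` even, `eo ≤ g + s0`), the scaled tokens `m₁ + eo = m`, `jl₁ + eo = jl` with the
weld's depth guard at `jl₁`, and a cutoff `C` (`jl₁ ≤ C`, `C + (g + s0) ≤ m₁ + jl₁ + 1`).  Then the CUT census difference over the cells of `μ₁ = tc⁻¹(λ − u)` is ★ p860773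
`toricCensusSum_ramM_weld_cut_v2`'s value at `(m₁, jl₁)`: the (C) value minus the cut top band.  Pure composition: ★ p857945 (K′ package) → ★ (C-1cls) class letters +
★ `exists_relative_translator` → ★ p858235 ∕ p858252 (tables) → ★ `levelSetDep_eq_of_generic_ramified` at μ₁ (GEN∕OFF) → (R1) `hC2TOPnear_of_letters_inv_mul` ∕
`hC2TOPfarE_of_letters_inv_mul` (near∕far at μ₁ with the alive offset) → ★ p860773 (cut weld ED. 2).
[cite: Rogawski1990, §4.9 pp. 55–58, Prop. 4.9.1, Lemma 4.9.3] [cite: Kottwitz1986BaseChangeUnits, §1 pp. 240–241] [cite: Flicker1998UnitaryFL, Prop. 7 p. 84] [cite: Serre1979, Ch. IV §1–§2; Ch. V §3] -/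
theorem toricCensusSum_ramM_weld_cut_of_frame
    {K : Type} [Field K] [Valued K ℤᵐ⁰] [CompleteSpace K] [IsDiscreteValuationRing 𝒪[K]] [Finite 𝓀[K]] {ρ Θ τ : K →+* K}
    (hρρ : ∀ x, ρ (ρ x) = x) (hvρ : ∀ x, Valued.v (ρ x) = Valued.v x)
    (hΘΘ : ∀ x, Θ (Θ x) = x) (hΘρ : ∀ x, Θ (ρ x) = ρ (Θ x)) (hvΘ : ∀ x, Valued.v (Θ x) = Valued.v x) (hτ : ∀ x, τ x = Θ (ρ x))
    (hΘres : ∀ x : K, Valued.v x ≤ 1 → Valued.v (x - Θ x) < 1)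
    {ϖM : K} (hϖM : Valued.v ϖM = exp (-1 : ℤ)) {dρ dΘ dτ t : ℕ}
    (hDρ : IsRamifiedQuadraticDatum ρ ϖM dρ t) (hDΘ : IsRamifiedQuadraticDatum Θ ϖM dΘ t) (hDτ : IsRamifiedQuadraticDatum τ ϖM dτ t)
    (hF4 : ∀ z : K, ρ z = z → Θ z = z → z ≠ 0 → ∃ n : ℤ, Valued.v z = exp (4 * n))
    (hFN : ∀ f : K, ρ f = f → Θ f = f → Valued.v f = 1 → ∃ z : K, z * Θ z = f)
    {c₀ : K} (hc₀ : Valued.v c₀ = 1) (hdich : ∀ u : K, Θ u = u → Valued.v u = 1 → (∃ z : K, z * Θ z = u) ∨ ∃ z : K, z * Θ z = c₀ * u)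
    {n₀ : K} (hΘn₀ : Θ n₀ = n₀) (hn₀1 : Valued.v n₀ = 1) (hn₀N : ¬ ∃ z : K, z * Θ z = n₀)
    {ϖE : K} (hϖE : Valued.v ϖE = exp (-2 : ℤ)) (hρϖ : ρ ϖE = ϖE)
    {q : ℕ} (hq : Nat.card 𝓀[K] = q) (hq2 : 2 ∣ q)
    {g s0 dK d' : ℕ} (hg2 : dΘ = 2 * g) (hs02 : dτ = 2 * s0) (hg1 : 1 ≤ g) (hs01 : 1 ≤ s0)
    (hdKv : Valued.v (ϖM * τ ϖM - ρ (ϖM * τ ϖM)) = exp (-(2 * (dK : ℤ)))) (hdK2 : 2 * dK = dρ + 2 * g)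
    (hd'v : Valued.v (ϖM * Θ ϖM - ρ (ϖM * Θ ϖM)) = exp (-(2 * (d' : ℤ)))) (hd'2 : 2 * d' = dρ + dτ)
    {h h' : K} (hΘh : Θ h = h) (hh : h ≠ 0) (hhyper : ∃ x : K, x ≠ 0 ∧ h * Θ x * x + ρ (h * Θ x * x) = 0)
    (hΘh' : Θ h' = h') (hh' : h' ≠ 0) (haniso : ¬ ∃ x : K, x ≠ 0 ∧ h' * Θ x * x + ρ (h' * Θ x * x) = 0)
    {vh vh' e e' : ℤ} (hvh : Valued.v h = exp (-vh)) (hvh' : Valued.v h' = exp (-vh')) (he : vh + dρ = 2 * e) (he' : vh' + dρ = 2 * e')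
    {lam u : K} (hlamΘ : lam * Θ lam = 1) (hu : ρ u = u) (hu1' : u * Θ u = 1)
    {m jl : ℕ} (hμ : Valued.v (lam - u) = Valued.v ϖE ^ m) (hjl : Valued.v ((lam - u) - ρ (lam - u)) = Valued.v (ϖE ^ jl * (ϖM - ρ ϖM)))
    {tc : K} (hρt : ρ tc = tc) {eo : ℕ} (hte : Valued.v tc = Valued.v ϖE ^ eo) (heo : eo % 2 = 0) {m₁ jl₁ : ℕ} (hme : m₁ + eo = m) (hjle' : jl₁ + eo = jl)
    (hjlg : jl % 2 = g % 2) (hmjl : m ≤ jl) (hdeep : 3 * (g + s0) ≤ m)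
    (hparW : m % 2 = (g + s0) % 2 ∨ jl + 2 ≤ m + 2 * g + s0)
    (hreg : (m + s0 ≤ jl ∧ (m + s0) % 2 = jl % 2) ∨ jl + 1 = m + s0)
    (ε : ℚ) (hεQ : ε = 1 ∨ (ε = -1 ∧ jl + 2 ≤ m + 2 * g + s0))
    -- (C-5b) Σ3 the four SIDE LETTERS (F0P3a-p01 (g34)): regime A (`m + s0 ≤ jl`) TP∕TE, regime B (`jl + 1 = m + s0`) the η-bits
    (hST : m + s0 ≤ jl → (∃ ω : K, Valued.v ω = 1 ∧
      Valued.v (ρ (lam - u) / (lam - u) * (ρ (ω * Θ ω) / (ω * Θ ω)) - 1) ≤ exp (-(2 * ((s0 : ℤ) + 2 * g - 1) + dρ))) → ε = 1)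
    (hSE : m + s0 ≤ jl → (∃ ω : K, Valued.v ω = 1 ∧
      Valued.v (ρ (lam - u) / (lam - u) * (ρ n₀ / n₀) * (ρ (ω * Θ ω) / (ω * Θ ω)) - 1) ≤ exp (-(2 * ((s0 : ℤ) + 2 * g - 1) + dρ))) → ε = -1)
    (hSP : jl + 1 = m + s0 → (∃ ω₁ : Kˣ, Valued.v (ω₁ : K) = 1 ∧
      Valued.v (1 + ρ h / h * (ρ (ϖM ^ ((m : ℤ) - jl - e) * Θ (ϖM ^ ((m : ℤ) - jl - e))) / (ϖM ^ ((m : ℤ) - jl - e) * Θ (ϖM ^ ((m : ℤ) - jl - e)))) /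
        (ρ (lam - u) / (lam - u)) * (ρ ((ω₁ : K) * Θ ω₁) / ((ω₁ : K) * Θ ω₁))) ≤ exp (-(2 * ((s0 : ℤ) + 2 * g - 1) + dρ))) → ε = 1)
    (hSM : jl + 1 = m + s0 → (∃ ω₁ : Kˣ, Valued.v (ω₁ : K) = 1 ∧
      Valued.v (1 + ρ h' / h' * (ρ (ϖM ^ ((m : ℤ) - jl - e') * Θ (ϖM ^ ((m : ℤ) - jl - e'))) / (ϖM ^ ((m : ℤ) - jl - e') * Θ (ϖM ^ ((m : ℤ) - jl - e')))) /
        (ρ (lam - u) / (lam - u)) * (ρ ((ω₁ : K) * Θ ω₁) / ((ω₁ : K) * Θ ω₁))) ≤ exp (-(2 * ((s0 : ℤ) + 2 * g - 1) + dρ))) → ε = -1)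
    (hed : eo ≤ g + s0) (hjlS₁ : 3 * g + 2 * s0 ≤ jl₁ + 2 + 2 * ((g + s0) % 2)) (C : ℕ) (hC : jl₁ ≤ C) (hCe : C + (g + s0) ≤ m₁ + jl₁ + 1) :
    ε * ∑ j ∈ range (jl₁ + 1), ∑ a ∈ range (jl₁ + 2), (q : ℚ) ^ a *
        (if j + a ≤ C then ((levelSetDep ρ Θ ϖM ϖE h j a (tc⁻¹ * (lam - u))).ncard : ℚ) - ((levelSetDep ρ Θ ϖM ϖE h' j a (tc⁻¹ * (lam - u))).ncard : ℚ) else 0) =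
      (q : ℚ) ^ m₁ * (2 * ∑ i ∈ range ((jl₁ - g) / 2 + 1), (q : ℚ) ^ i - 2 * ∑ i ∈ range (g + s0 - (g + s0) % 2), (q : ℚ) ^ i) -
        2 * ∑ a ∈ (range (jl₁ + 2)).filter (fun a => a ≤ m₁ ∧ C + m₁ < jl₁ + 2 * a ∧ 2 * m₁ + 2 * g + s0 < jl₁ + 2 * a + 2 ∧ 2 * a + (g + s0) ≤ 2 * m₁ + 1),
          (q : ℚ) ^ (a + (jl₁ + s0) / 2) := by
  -- token arithmetic of the scaled multiplier (§0): class of `jl₁`, parity-or-window, depth guards, sign window, far-organ guards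
  obtain ⟨hjl₁g, hparW₁, hmS₁, hm₁, hwin, hmd, hjlS1⟩ := scaledLetters_std heo hed hme hjle' hjlg hmjl hdeep hparW
  have hds : 2 * d' = dρ + 2 * s0 := by omega
  -- (C-0c) THE THIRD-FIELD PACKAGE `K′ = K♮` (★ p857945, LH4-p07)
  obtain ⟨K', instF', instV', σ', π', jK, instDVR', instFin', hqK', instCS', hσ', hvσ', hfix', hπ', hdd', hjleK, hjΘ, hjfixΘ, hjσ, hjπ, -⟩ :=
    exists_thirdFieldPackage_ramM hρρ hvρ hΘρ hDΘ hΘres hF4 hd'v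
  have hqK'q : Nat.card 𝓀[K'] = q := hqK'.trans hq
  -- (C-1cls) letters of the class-letter heads: `P := ϖM·ΘϖM`, `d′` = the dictionary's (`hd'v`)
  have hΘPcls : Θ (ϖM * Θ ϖM) = ϖM * Θ ϖM := by rw [map_mul, hΘΘ, mul_comm]
  have hvPcls : Valued.v (ϖM * Θ ϖM) = exp (-2 : ℤ) := by rw [map_mul, hvΘ, hϖM, ← exp_add]; rfl
  have hϖMne : ϖM ≠ 0 := fun h0 => by rw [h0, map_zero] at hϖM; exact (WithZero.coe_ne_zero hϖM.symm).elim
  have hcls0 : ∀ k₀ : ℤ, Valued.v (1 + ρ h / h * (ρ (ϖM ^ k₀ * Θ (ϖM ^ k₀)) / (ϖM ^ k₀ * Θ (ϖM ^ k₀)))) ≤ exp (-(2 * (d' : ℤ) - 2)) := by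
    exact F0P3cDyRamClassLettersRamM.hcls0_ramM hρρ hΘΘ hΘρ hF4 hΘPcls hvPcls hd'v hϖMne hΘh hh
  have hclsT : ∀ k₀ : ℤ, (∃ r : ℤ, k₀ + s0 + e = 2 * r) → ∃ ω₀ : Kˣ, Valued.v (ω₀ : K) = 1 ∧
      ρ h / h * (ρ (ϖM ^ k₀ * Θ (ϖM ^ k₀)) / (ϖM ^ k₀ * Θ (ϖM ^ k₀))) * (ρ ((ω₀ : K) * Θ ω₀) / ((ω₀ : K) * Θ ω₀)) = -1 := by
    exact F0P3cDyRamClassLettersRamM.hclsT_ramM hρρ hΘΘ hΘρ hvΘ hF4 hΘPcls hd'v hϖM hϖE hρϖ hΘh hh hvh he hds hhyper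
  have hclsO : ∀ k₀ : ℤ, (∃ r : ℤ, k₀ + s0 + e = 2 * r + 1) → ∀ ω : Kˣ, Valued.v (ω : K) = 1 →
      ¬ Valued.v (1 + ρ h / h * (ρ (ϖM ^ k₀ * Θ (ϖM ^ k₀)) / (ϖM ^ k₀ * Θ (ϖM ^ k₀))) * (ρ ((ω : K) * Θ ω) / ((ω : K) * Θ ω))) ≤
        exp (-(2 * (d' : ℤ))) := by
    exact F0P3cDyRamClassLettersRamM.hclsO_ramM hρρ hΘΘ hΘρ hvΘ hF4 hΘPcls hvPcls hd'v hϖM hΘh hh hvh he hds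
  have hcls0' : ∀ k₀ : ℤ, Valued.v (1 + ρ h' / h' * (ρ (ϖM ^ k₀ * Θ (ϖM ^ k₀)) / (ϖM ^ k₀ * Θ (ϖM ^ k₀)))) ≤ exp (-(2 * (d' : ℤ) - 2)) := by
    exact F0P3cDyRamClassLettersRamM.hcls0_ramM hρρ hΘΘ hΘρ hF4 hΘPcls hvPcls hd'v hϖMne hΘh' hh'
  have hclsE : ∀ k₀ : ℤ, (∃ r : ℤ, k₀ + s0 + e' = 2 * r) → ∃ ω₀ : Kˣ, Valued.v (ω₀ : K) = 1 ∧
      ρ h' / h' * (ρ (ϖM ^ k₀ * Θ (ϖM ^ k₀)) / (ϖM ^ k₀ * Θ (ϖM ^ k₀))) * (ρ ((ω₀ : K) * Θ ω₀) / ((ω₀ : K) * Θ ω₀)) * (ρ n₀ / n₀) = -1 := by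
    exact F0P3cDyRamClassLettersRamM.hclsE_ramM hρρ hΘΘ hΘρ hvΘ hc₀ hdich hΘn₀ hn₀1 hn₀N hΘPcls hd'v hϖM hϖE hρϖ hΘh' hh' hvh' he' hds haniso
  have hclsO' : ∀ k₀ : ℤ, (∃ r : ℤ, k₀ + s0 + e' = 2 * r + 1) → ∀ ω : Kˣ, Valued.v (ω : K) = 1 →
      ¬ Valued.v (1 + ρ h' / h' * (ρ (ϖM ^ k₀ * Θ (ϖM ^ k₀)) / (ϖM ^ k₀ * Θ (ϖM ^ k₀))) * (ρ ((ω : K) * Θ ω) / ((ω : K) * Θ ω))) ≤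
        exp (-(2 * (d' : ℤ))) := by
    exact F0P3cDyRamClassLettersRamM.hclsO_ramM hρρ hΘΘ hΘρ hvΘ hF4 hΘPcls hvPcls hd'v hϖM hΘh' hh' hvh' he' hds
  -- (C-1) THE u-FREE TABLES (★ p858235 ∕ ★ p858252, LH4-p06 (g5))
  have hC1P : ∀ j a, (levelSet ρ Θ ϖM (ϖE) h j a).ncard = _ := fun j a =>
    ncard_levelSet_eq_hnP hDρ hΘρ hvΘ hϖE hρϖ hq hqK'q hq2 hσ' hvσ' hfix' hπ' hdd' jK hjleK hjΘ hjfixΘ hjσ hjπ hDΘ hFN hΘh hh hvh he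
      hg2 hds hs01 hcls0 hclsT hclsO j a
  have hC1M : ∀ j a, (levelSet ρ Θ ϖM (ϖE) h' j a).ncard = _ := fun j a =>
    ncard_levelSet_eq_hnM hDρ hΘρ hvΘ hϖE hρϖ hq hqK'q hσ' hvσ' hfix' hπ' hdd' jK hjleK hjΘ hjfixΘ hjσ hjπ hDΘ hFN hΘn₀ hn₀1 hn₀N hΘh' hh' hvh' he'
      hg2 hds hs01 hcls0' hclsE hclsO' j a
  -- (C-2TOPnear) NEAR TOP CELLS AGREE (★ p858164, LH4-p06 (g5)) — modulo the RELATIVE CLASS LETTER `hrel` ((C-1cls), F0P3a-p01 (g34))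
  obtain ⟨ω_r, hω_r, hrel⟩ : ∃ ω_r : Kˣ, Valued.v (ω_r : K) = 1 ∧
      ρ h' / h' * (ρ (ϖM ^ (m - jl - e' : ℤ) * Θ (ϖM ^ (m - jl - e' : ℤ))) / (ϖM ^ (m - jl - e' : ℤ) * Θ (ϖM ^ (m - jl - e' : ℤ)))) =
        ρ h / h * (ρ (ϖM ^ (m - jl - e : ℤ) * Θ (ϖM ^ (m - jl - e : ℤ))) / (ϖM ^ (m - jl - e : ℤ) * Θ (ϖM ^ (m - jl - e : ℤ)))) * (ρ n₀ / n₀) *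
          (ρ ((ω_r : K) * Θ ω_r) / ((ω_r : K) * Θ ω_r)) := by
    exact exists_relative_translator (ρ := ρ) hΘΘ hvΘ hc₀ hdich hΘn₀ hn₀1 hn₀N hϖM hΘh hΘh' hh hh' hhyper haniso hvh hvh'
      (k₀ := (m : ℤ) - jl - e) (k₀' := (m : ℤ) - jl - e') (by omega)   -- ★ (F0P3a-p01 (g34)) `exists_relative_translator`
  -- the SCALED multiplier `μ₁ = tc⁻¹(λ − u)`: tokens `(m₁, jl₁)` ((R1) `tokens_inv_mul`)
  obtain ⟨hμ₁, hjl₁, -⟩ := tokens_inv_mul (ρ := ρ) (α := ϖM) hϖE hμ hjl hρt hte hme hjle'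
  -- (C-2TOPnear) at μ₁ ((R1) `hC2TOPnear_of_letters_inv_mul` over ★ p858164)
  have hC2near := hC2TOPnear_of_letters_inv_mul hDρ hΘρ hvΘ hϖE hρϖ hq hσ' hvσ' hfix' hπ' hdd' jK hjleK hjΘ hjfixΘ hjσ hjπ hDΘ hFN hΘn₀ hn₀1 hn₀N
    hh hvh hh' hvh' hμ hjl hρt hte hme hjle' hg2 hs02 hd'2 he he' hω_r hrel
  -- (C-2TOPfarE) at μ₁ with the alive offset ((R1) `hC2TOPfarE_of_letters_inv_mul`): the τ-datum, `P := ϖM·τϖM`, class letters, `hrel`, SIDE LETTERS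
  have hτP : τ (ϖM * τ ϖM) = ϖM * τ ϖM := by rw [map_mul, hDτ.1, mul_comm]
  have hPτ : Valued.v (ϖM * τ ϖM) = exp (-2 : ℤ) := by rw [map_mul, hDτ.2.1, hϖM, ← exp_add]; rfl
  have hC2far := hC2TOPfarE_of_letters_inv_mul hDρ hΘρ hvΘ hτ hDτ hτP hPτ hdKv hσ' hvσ' hfix' hπ' hdd' jK hjleK hjΘ hjfixΘ hjσ hjπ hDΘ hFN hΘn₀ hn₀1 hn₀N
    hϖE hρϖ hq hqK'q hq2 hΘh hh hvh hΘh' hh' hvh' hlamΘ hu hu1' hμ hjl hρt hte hme hjle' hg2 hs02 hd'2 hdK2 he he' hreg hmd hjlS1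
    hcls0 hclsT hclsO hcls0' hclsE hclsO' hω_r hrel ε hST hSE hSP hSM
  -- (R2) THE CUT WELD ED. 2 (★ p860773) at `(m₁, jl₁, μ₁)` — GEN∕OFF by ★ `levelSetDep_eq_of_generic_ramified` at μ₁'s tokens
  have hq2le : 2 ≤ q := by
    have h1 : 1 < Nat.card 𝓀[K] := Finite.one_lt_card
    omega
  have hε₁ : ε = 1 ∨ (ε = -1 ∧ jl₁ + 2 ≤ m₁ + 2 * g + s0) := hεQ.imp_right fun h1 => ⟨h1.1, hwin h1.2⟩
  exact toricCensusSum_ramM_weld_cut_v2 (Θ := Θ) (μ := tc⁻¹ * (lam - u)) hDρ hvΘ hρϖ hϖE hh hh' q ε hq2le hg1 hs01 hjl₁g hjlS₁ hparW₁ hmS₁ hm₁ hε₁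
    hC1P hC1M
    (fun j a hj _ hG => by   -- (C-2GEN) ★ RamMDep at μ₁
      have hG' : a ≤ m₁ ∧ (j ≤ m₁ - a ∨ (2 * a ≤ m₁ ∧ j + a ≤ jl₁)) := ⟨hG.1, hG.2.imp_left fun h1 => by omega⟩
      exact ⟨by rw [levelSetDep_eq_of_generic_ramified hDρ hΘΘ hΘρ hvΘ hρϖ hϖE hh hμ₁ hjl₁ hj (Or.inr hG'), if_pos hG'],
        by rw [levelSetDep_eq_of_generic_ramified hDρ hΘΘ hΘρ hvΘ hρϖ hϖE hh' hμ₁ hjl₁ hj (Or.inr hG'), if_pos hG']⟩)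
    (fun j a hj _ hnG hoff => by   -- (C-2OFF) ★ RamMDep at μ₁
      have hnG' : ¬ (a ≤ m₁ ∧ (j ≤ m₁ - a ∨ (2 * a ≤ m₁ ∧ j + a ≤ jl₁))) := fun h1 => hnG ⟨h1.1, h1.2.imp_left fun h2 => by omega⟩
      exact ⟨by rw [levelSetDep_eq_of_generic_ramified hDρ hΘΘ hΘρ hvΘ hρϖ hϖE hh hμ₁ hjl₁ hj (Or.inl hoff), if_neg hnG'],
        by rw [levelSetDep_eq_of_generic_ramified hDρ hΘΘ hΘρ hvΘ hρϖ hϖE hh' hμ₁ hjl₁ hj (Or.inl hoff), if_neg hnG']⟩)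
    hC2near eo hed hC2far C hC hCe

/-! ## §2 Flipped class (`eo` odd) -/

/-- **(R2-frame)♭ THE CUT WELD OF THE FRAME AT THE SCALED MULTIPLIER — type RamM, FLIPPED CLASS (`eo` odd), BOTH PARITY REGIMES.**  As `toricCensusSum_ramM_weld_cut_of_frame`
with `eo` odd (so `jl₁ ≡ g + 1`, `m₁`'s parity letter flips) and the flipped depth guard `3g + 2s0 ≤ jl₁ + 3`; the value is ★ p860773 `toricCensusSum_ramM_weld_cut_flip_v2`'s at
`(m₁, jl₁)`.  Same composition.
[cite: Rogawski1990, §4.9 pp. 55–58, Prop. 4.9.1, Lemma 4.9.3] [cite: Kottwitz1986BaseChangeUnits, §1 pp. 240–241] [cite: Flicker1998UnitaryFL, Prop. 7 p. 84] [cite: Serre1979, Ch. IV §1–§2; Ch. V §3] -/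
theorem toricCensusSum_ramM_weld_cut_of_frame_flip
    {K : Type} [Field K] [Valued K ℤᵐ⁰] [CompleteSpace K] [IsDiscreteValuationRing 𝒪[K]] [Finite 𝓀[K]] {ρ Θ τ : K →+* K}
    (hρρ : ∀ x, ρ (ρ x) = x) (hvρ : ∀ x, Valued.v (ρ x) = Valued.v x)
    (hΘΘ : ∀ x, Θ (Θ x) = x) (hΘρ : ∀ x, Θ (ρ x) = ρ (Θ x)) (hvΘ : ∀ x, Valued.v (Θ x) = Valued.v x) (hτ : ∀ x, τ x = Θ (ρ x))
    (hΘres : ∀ x : K, Valued.v x ≤ 1 → Valued.v (x - Θ x) < 1)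
    {ϖM : K} (hϖM : Valued.v ϖM = exp (-1 : ℤ)) {dρ dΘ dτ t : ℕ}
    (hDρ : IsRamifiedQuadraticDatum ρ ϖM dρ t) (hDΘ : IsRamifiedQuadraticDatum Θ ϖM dΘ t) (hDτ : IsRamifiedQuadraticDatum τ ϖM dτ t)
    (hF4 : ∀ z : K, ρ z = z → Θ z = z → z ≠ 0 → ∃ n : ℤ, Valued.v z = exp (4 * n))
    (hFN : ∀ f : K, ρ f = f → Θ f = f → Valued.v f = 1 → ∃ z : K, z * Θ z = f)
    {c₀ : K} (hc₀ : Valued.v c₀ = 1) (hdich : ∀ u : K, Θ u = u → Valued.v u = 1 → (∃ z : K, z * Θ z = u) ∨ ∃ z : K, z * Θ z = c₀ * u)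
    {n₀ : K} (hΘn₀ : Θ n₀ = n₀) (hn₀1 : Valued.v n₀ = 1) (hn₀N : ¬ ∃ z : K, z * Θ z = n₀)
    {ϖE : K} (hϖE : Valued.v ϖE = exp (-2 : ℤ)) (hρϖ : ρ ϖE = ϖE)
    {q : ℕ} (hq : Nat.card 𝓀[K] = q) (hq2 : 2 ∣ q)
    {g s0 dK d' : ℕ} (hg2 : dΘ = 2 * g) (hs02 : dτ = 2 * s0) (hg1 : 1 ≤ g) (hs01 : 1 ≤ s0)
    (hdKv : Valued.v (ϖM * τ ϖM - ρ (ϖM * τ ϖM)) = exp (-(2 * (dK : ℤ)))) (hdK2 : 2 * dK = dρ + 2 * g)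
    (hd'v : Valued.v (ϖM * Θ ϖM - ρ (ϖM * Θ ϖM)) = exp (-(2 * (d' : ℤ)))) (hd'2 : 2 * d' = dρ + dτ)
    {h h' : K} (hΘh : Θ h = h) (hh : h ≠ 0) (hhyper : ∃ x : K, x ≠ 0 ∧ h * Θ x * x + ρ (h * Θ x * x) = 0)
    (hΘh' : Θ h' = h') (hh' : h' ≠ 0) (haniso : ¬ ∃ x : K, x ≠ 0 ∧ h' * Θ x * x + ρ (h' * Θ x * x) = 0)
    {vh vh' e e' : ℤ} (hvh : Valued.v h = exp (-vh)) (hvh' : Valued.v h' = exp (-vh')) (he : vh + dρ = 2 * e) (he' : vh' + dρ = 2 * e')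
    {lam u : K} (hlamΘ : lam * Θ lam = 1) (hu : ρ u = u) (hu1' : u * Θ u = 1)
    {m jl : ℕ} (hμ : Valued.v (lam - u) = Valued.v ϖE ^ m) (hjl : Valued.v ((lam - u) - ρ (lam - u)) = Valued.v (ϖE ^ jl * (ϖM - ρ ϖM)))
    {tc : K} (hρt : ρ tc = tc) {eo : ℕ} (hte : Valued.v tc = Valued.v ϖE ^ eo) (heo : eo % 2 = 1) {m₁ jl₁ : ℕ} (hme : m₁ + eo = m) (hjle' : jl₁ + eo = jl)
    (hjlg : jl % 2 = g % 2) (hmjl : m ≤ jl) (hdeep : 3 * (g + s0) ≤ m)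
    (hparW : m % 2 = (g + s0) % 2 ∨ jl + 2 ≤ m + 2 * g + s0)
    (hreg : (m + s0 ≤ jl ∧ (m + s0) % 2 = jl % 2) ∨ jl + 1 = m + s0)
    (ε : ℚ) (hεQ : ε = 1 ∨ (ε = -1 ∧ jl + 2 ≤ m + 2 * g + s0))
    -- (C-5b) Σ3 the four SIDE LETTERS (F0P3a-p01 (g34)): regime A (`m + s0 ≤ jl`) TP∕TE, regime B (`jl + 1 = m + s0`) the η-bits
    (hST : m + s0 ≤ jl → (∃ ω : K, Valued.v ω = 1 ∧
      Valued.v (ρ (lam - u) / (lam - u) * (ρ (ω * Θ ω) / (ω * Θ ω)) - 1) ≤ exp (-(2 * ((s0 : ℤ) + 2 * g - 1) + dρ))) → ε = 1)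
    (hSE : m + s0 ≤ jl → (∃ ω : K, Valued.v ω = 1 ∧
      Valued.v (ρ (lam - u) / (lam - u) * (ρ n₀ / n₀) * (ρ (ω * Θ ω) / (ω * Θ ω)) - 1) ≤ exp (-(2 * ((s0 : ℤ) + 2 * g - 1) + dρ))) → ε = -1)
    (hSP : jl + 1 = m + s0 → (∃ ω₁ : Kˣ, Valued.v (ω₁ : K) = 1 ∧
      Valued.v (1 + ρ h / h * (ρ (ϖM ^ ((m : ℤ) - jl - e) * Θ (ϖM ^ ((m : ℤ) - jl - e))) / (ϖM ^ ((m : ℤ) - jl - e) * Θ (ϖM ^ ((m : ℤ) - jl - e)))) /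
        (ρ (lam - u) / (lam - u)) * (ρ ((ω₁ : K) * Θ ω₁) / ((ω₁ : K) * Θ ω₁))) ≤ exp (-(2 * ((s0 : ℤ) + 2 * g - 1) + dρ))) → ε = 1)
    (hSM : jl + 1 = m + s0 → (∃ ω₁ : Kˣ, Valued.v (ω₁ : K) = 1 ∧
      Valued.v (1 + ρ h' / h' * (ρ (ϖM ^ ((m : ℤ) - jl - e') * Θ (ϖM ^ ((m : ℤ) - jl - e'))) / (ϖM ^ ((m : ℤ) - jl - e') * Θ (ϖM ^ ((m : ℤ) - jl - e')))) /
        (ρ (lam - u) / (lam - u)) * (ρ ((ω₁ : K) * Θ ω₁) / ((ω₁ : K) * Θ ω₁))) ≤ exp (-(2 * ((s0 : ℤ) + 2 * g - 1) + dρ))) → ε = -1)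
    (hed : eo ≤ g + s0) (hjlS₁ : 3 * g + 2 * s0 ≤ jl₁ + 3) (C : ℕ) (hC : jl₁ ≤ C) (hCe : C + (g + s0) ≤ m₁ + jl₁ + 1) :
    ε * ∑ j ∈ range (jl₁ + 1), ∑ a ∈ range (jl₁ + 2), (q : ℚ) ^ a *
        (if j + a ≤ C then ((levelSetDep ρ Θ ϖM ϖE h j a (tc⁻¹ * (lam - u))).ncard : ℚ) - ((levelSetDep ρ Θ ϖM ϖE h' j a (tc⁻¹ * (lam - u))).ncard : ℚ) else 0) =
      (q : ℚ) ^ m₁ * (2 * ∑ i ∈ range ((jl₁ + 1 - g) / 2 + (g + s0) % 2), (q : ℚ) ^ i - 2 * ∑ i ∈ range (g + s0 - 1 + (g + s0) % 2), (q : ℚ) ^ i) -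
        2 * ∑ a ∈ (range (jl₁ + 2)).filter (fun a => a ≤ m₁ ∧ C + m₁ < jl₁ + 2 * a ∧ 2 * m₁ + 2 * g + s0 < jl₁ + 2 * a + 2 ∧ 2 * a + (g + s0) ≤ 2 * m₁ + 1),
          (q : ℚ) ^ (a + (jl₁ + s0) / 2) := by
  -- token arithmetic of the scaled multiplier (§0): class of `jl₁`, parity-or-window, depth guards, sign window, far-organ guards
  obtain ⟨hjl₁g, hparW₁, hmS₁, hm₁, hwin, hmd, hjlS1⟩ := scaledLetters_flip heo hed hme hjle' hjlg hmjl hdeep hparW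
  have hds : 2 * d' = dρ + 2 * s0 := by omega
  -- (C-0c) THE THIRD-FIELD PACKAGE `K′ = K♮` (★ p857945, LH4-p07)
  obtain ⟨K', instF', instV', σ', π', jK, instDVR', instFin', hqK', instCS', hσ', hvσ', hfix', hπ', hdd', hjleK, hjΘ, hjfixΘ, hjσ, hjπ, -⟩ :=
    exists_thirdFieldPackage_ramM hρρ hvρ hΘρ hDΘ hΘres hF4 hd'v
  have hqK'q : Nat.card 𝓀[K'] = q := hqK'.trans hq
  -- (C-1cls) letters of the class-letter heads: `P := ϖM·ΘϖM`, `d′` = the dictionary's (`hd'v`)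
  have hΘPcls : Θ (ϖM * Θ ϖM) = ϖM * Θ ϖM := by rw [map_mul, hΘΘ, mul_comm]
  have hvPcls : Valued.v (ϖM * Θ ϖM) = exp (-2 : ℤ) := by rw [map_mul, hvΘ, hϖM, ← exp_add]; rfl
  have hϖMne : ϖM ≠ 0 := fun h0 => by rw [h0, map_zero] at hϖM; exact (WithZero.coe_ne_zero hϖM.symm).elim
  have hcls0 : ∀ k₀ : ℤ, Valued.v (1 + ρ h / h * (ρ (ϖM ^ k₀ * Θ (ϖM ^ k₀)) / (ϖM ^ k₀ * Θ (ϖM ^ k₀)))) ≤ exp (-(2 * (d' : ℤ) - 2)) := by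
    exact F0P3cDyRamClassLettersRamM.hcls0_ramM hρρ hΘΘ hΘρ hF4 hΘPcls hvPcls hd'v hϖMne hΘh hh
  have hclsT : ∀ k₀ : ℤ, (∃ r : ℤ, k₀ + s0 + e = 2 * r) → ∃ ω₀ : Kˣ, Valued.v (ω₀ : K) = 1 ∧
      ρ h / h * (ρ (ϖM ^ k₀ * Θ (ϖM ^ k₀)) / (ϖM ^ k₀ * Θ (ϖM ^ k₀))) * (ρ ((ω₀ : K) * Θ ω₀) / ((ω₀ : K) * Θ ω₀)) = -1 := by
    exact F0P3cDyRamClassLettersRamM.hclsT_ramM hρρ hΘΘ hΘρ hvΘ hF4 hΘPcls hd'v hϖM hϖE hρϖ hΘh hh hvh he hds hhyper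
  have hclsO : ∀ k₀ : ℤ, (∃ r : ℤ, k₀ + s0 + e = 2 * r + 1) → ∀ ω : Kˣ, Valued.v (ω : K) = 1 →
      ¬ Valued.v (1 + ρ h / h * (ρ (ϖM ^ k₀ * Θ (ϖM ^ k₀)) / (ϖM ^ k₀ * Θ (ϖM ^ k₀))) * (ρ ((ω : K) * Θ ω) / ((ω : K) * Θ ω))) ≤
        exp (-(2 * (d' : ℤ))) := by
    exact F0P3cDyRamClassLettersRamM.hclsO_ramM hρρ hΘΘ hΘρ hvΘ hF4 hΘPcls hvPcls hd'v hϖM hΘh hh hvh he hds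
  have hcls0' : ∀ k₀ : ℤ, Valued.v (1 + ρ h' / h' * (ρ (ϖM ^ k₀ * Θ (ϖM ^ k₀)) / (ϖM ^ k₀ * Θ (ϖM ^ k₀)))) ≤ exp (-(2 * (d' : ℤ) - 2)) := by
    exact F0P3cDyRamClassLettersRamM.hcls0_ramM hρρ hΘΘ hΘρ hF4 hΘPcls hvPcls hd'v hϖMne hΘh' hh'
  have hclsE : ∀ k₀ : ℤ, (∃ r : ℤ, k₀ + s0 + e' = 2 * r) → ∃ ω₀ : Kˣ, Valued.v (ω₀ : K) = 1 ∧
      ρ h' / h' * (ρ (ϖM ^ k₀ * Θ (ϖM ^ k₀)) / (ϖM ^ k₀ * Θ (ϖM ^ k₀))) * (ρ ((ω₀ : K) * Θ ω₀) / ((ω₀ : K) * Θ ω₀)) * (ρ n₀ / n₀) = -1 := by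
    exact F0P3cDyRamClassLettersRamM.hclsE_ramM hρρ hΘΘ hΘρ hvΘ hc₀ hdich hΘn₀ hn₀1 hn₀N hΘPcls hd'v hϖM hϖE hρϖ hΘh' hh' hvh' he' hds haniso
  have hclsO' : ∀ k₀ : ℤ, (∃ r : ℤ, k₀ + s0 + e' = 2 * r + 1) → ∀ ω : Kˣ, Valued.v (ω : K) = 1 →
      ¬ Valued.v (1 + ρ h' / h' * (ρ (ϖM ^ k₀ * Θ (ϖM ^ k₀)) / (ϖM ^ k₀ * Θ (ϖM ^ k₀))) * (ρ ((ω : K) * Θ ω) / ((ω : K) * Θ ω))) ≤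
        exp (-(2 * (d' : ℤ))) := by
    exact F0P3cDyRamClassLettersRamM.hclsO_ramM hρρ hΘΘ hΘρ hvΘ hF4 hΘPcls hvPcls hd'v hϖM hΘh' hh' hvh' he' hds
  -- (C-1) THE u-FREE TABLES (★ p858235 ∕ ★ p858252, LH4-p06 (g5))
  have hC1P : ∀ j a, (levelSet ρ Θ ϖM (ϖE) h j a).ncard = _ := fun j a =>
    ncard_levelSet_eq_hnP hDρ hΘρ hvΘ hϖE hρϖ hq hqK'q hq2 hσ' hvσ' hfix' hπ' hdd' jK hjleK hjΘ hjfixΘ hjσ hjπ hDΘ hFN hΘh hh hvh he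
      hg2 hds hs01 hcls0 hclsT hclsO j a
  have hC1M : ∀ j a, (levelSet ρ Θ ϖM (ϖE) h' j a).ncard = _ := fun j a =>
    ncard_levelSet_eq_hnM hDρ hΘρ hvΘ hϖE hρϖ hq hqK'q hσ' hvσ' hfix' hπ' hdd' jK hjleK hjΘ hjfixΘ hjσ hjπ hDΘ hFN hΘn₀ hn₀1 hn₀N hΘh' hh' hvh' he'
      hg2 hds hs01 hcls0' hclsE hclsO' j a
  -- (C-2TOPnear) NEAR TOP CELLS AGREE (★ p858164, LH4-p06 (g5)) — modulo the RELATIVE CLASS LETTER `hrel` ((C-1cls), F0P3a-p01 (g34))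
  obtain ⟨ω_r, hω_r, hrel⟩ : ∃ ω_r : Kˣ, Valued.v (ω_r : K) = 1 ∧
      ρ h' / h' * (ρ (ϖM ^ (m - jl - e' : ℤ) * Θ (ϖM ^ (m - jl - e' : ℤ))) / (ϖM ^ (m - jl - e' : ℤ) * Θ (ϖM ^ (m - jl - e' : ℤ)))) =
        ρ h / h * (ρ (ϖM ^ (m - jl - e : ℤ) * Θ (ϖM ^ (m - jl - e : ℤ))) / (ϖM ^ (m - jl - e : ℤ) * Θ (ϖM ^ (m - jl - e : ℤ)))) * (ρ n₀ / n₀) *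
          (ρ ((ω_r : K) * Θ ω_r) / ((ω_r : K) * Θ ω_r)) := by
    exact exists_relative_translator (ρ := ρ) hΘΘ hvΘ hc₀ hdich hΘn₀ hn₀1 hn₀N hϖM hΘh hΘh' hh hh' hhyper haniso hvh hvh'
      (k₀ := (m : ℤ) - jl - e) (k₀' := (m : ℤ) - jl - e') (by omega)   -- ★ (F0P3a-p01 (g34)) `exists_relative_translator`
  -- the SCALED multiplier `μ₁ = tc⁻¹(λ − u)`: tokens `(m₁, jl₁)` ((R1) `tokens_inv_mul`)
  obtain ⟨hμ₁, hjl₁, -⟩ := tokens_inv_mul (ρ := ρ) (α := ϖM) hϖE hμ hjl hρt hte hme hjle'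
  -- (C-2TOPnear) at μ₁ ((R1) `hC2TOPnear_of_letters_inv_mul` over ★ p858164)
  have hC2near := hC2TOPnear_of_letters_inv_mul hDρ hΘρ hvΘ hϖE hρϖ hq hσ' hvσ' hfix' hπ' hdd' jK hjleK hjΘ hjfixΘ hjσ hjπ hDΘ hFN hΘn₀ hn₀1 hn₀N
    hh hvh hh' hvh' hμ hjl hρt hte hme hjle' hg2 hs02 hd'2 he he' hω_r hrel
  -- (C-2TOPfarE) at μ₁ with the alive offset ((R1) `hC2TOPfarE_of_letters_inv_mul`): the τ-datum, `P := ϖM·τϖM`, class letters, `hrel`, SIDE LETTERS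
  have hτP : τ (ϖM * τ ϖM) = ϖM * τ ϖM := by rw [map_mul, hDτ.1, mul_comm]
  have hPτ : Valued.v (ϖM * τ ϖM) = exp (-2 : ℤ) := by rw [map_mul, hDτ.2.1, hϖM, ← exp_add]; rfl
  have hC2far := hC2TOPfarE_of_letters_inv_mul hDρ hΘρ hvΘ hτ hDτ hτP hPτ hdKv hσ' hvσ' hfix' hπ' hdd' jK hjleK hjΘ hjfixΘ hjσ hjπ hDΘ hFN hΘn₀ hn₀1 hn₀N
    hϖE hρϖ hq hqK'q hq2 hΘh hh hvh hΘh' hh' hvh' hlamΘ hu hu1' hμ hjl hρt hte hme hjle' hg2 hs02 hd'2 hdK2 he he' hreg hmd hjlS1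
    hcls0 hclsT hclsO hcls0' hclsE hclsO' hω_r hrel ε hST hSE hSP hSM
  -- (R2) THE CUT WELD ED. 2 (★ p860773) at `(m₁, jl₁, μ₁)` — GEN∕OFF by ★ `levelSetDep_eq_of_generic_ramified` at μ₁'s tokens
  have hq2le : 2 ≤ q := by
    have h1 : 1 < Nat.card 𝓀[K] := Finite.one_lt_card
    omega
  have hε₁ : ε = 1 ∨ (ε = -1 ∧ jl₁ + 2 ≤ m₁ + 2 * g + s0) := hεQ.imp_right fun h1 => ⟨h1.1, hwin h1.2⟩
  exact toricCensusSum_ramM_weld_cut_flip_v2 (Θ := Θ) (μ := tc⁻¹ * (lam - u)) hDρ hvΘ hρϖ hϖE hh hh' q ε hq2le hg1 hs01 hjl₁g hjlS₁ hparW₁ hmS₁ hm₁ hε₁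
    hC1P hC1M
    (fun j a hj _ hG => by   -- (C-2GEN) ★ RamMDep at μ₁
      have hG' : a ≤ m₁ ∧ (j ≤ m₁ - a ∨ (2 * a ≤ m₁ ∧ j + a ≤ jl₁)) := ⟨hG.1, hG.2.imp_left fun h1 => by omega⟩
      exact ⟨by rw [levelSetDep_eq_of_generic_ramified hDρ hΘΘ hΘρ hvΘ hρϖ hϖE hh hμ₁ hjl₁ hj (Or.inr hG'), if_pos hG'],
        by rw [levelSetDep_eq_of_generic_ramified hDρ hΘΘ hΘρ hvΘ hρϖ hϖE hh' hμ₁ hjl₁ hj (Or.inr hG'), if_pos hG']⟩)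
    (fun j a hj _ hnG hoff => by   -- (C-2OFF) ★ RamMDep at μ₁
      have hnG' : ¬ (a ≤ m₁ ∧ (j ≤ m₁ - a ∨ (2 * a ≤ m₁ ∧ j + a ≤ jl₁))) := fun h1 => hnG ⟨h1.1, h1.2.imp_left fun h2 => by omega⟩
      exact ⟨by rw [levelSetDep_eq_of_generic_ramified hDρ hΘΘ hΘρ hvΘ hρϖ hϖE hh hμ₁ hjl₁ hj (Or.inl hoff), if_neg hnG'],
        by rw [levelSetDep_eq_of_generic_ramified hDρ hΘΘ hΘρ hvΘ hρϖ hϖE hh' hμ₁ hjl₁ hj (Or.inl hoff), if_neg hnG']⟩)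
    hC2near eo hed hC2far C hC hCe

end Summit.HodgeConjecture.HodgeConjecture.Cruxes.H413.F0P3cDyRamToricCensusSumRamMWeldCutOfFrame

end
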